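import Mathlib.MeasureTheory.Measure.Lebesgue.EqHaar
import Mathlib.LinearAlgebra.LinearIndependent.Defs
import Mathlib.LinearAlgebra.Matrix.DotProduct
import HarnessLib

/-!
# Uniqueness of sparse solutions of underdetermined linear systems (Spark; Donoho–Elad 2003)
# and identifiability of BINARY signals from one generic measurement

Vocabulary file (0 facts, 0 sorry) for the compressed-sensing notions behind register row E-61
(pub-qadeq lane; honest framing: instance-level adjudication of specific advantage claims; no claim
about BQP vs BPP or the summit): W. Hahn, N. Romero, *Computational Phase Transitions in Binary
Compressed Sensing: Quantum Annealing Inside the Relaxation Gap*, arXiv:2606.00806 (2026)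
[HahnRomero2026], held text `paper:arxiv-2606.00806` p0002:

> §II.A "Given a k-sparse binary signal x ∈ {0,1}ⁿ and m < n measurements y = Ax where
> A ∈ ℝ^{m×n}, recovery seeks the sparsest consistent solution." §II.B "The relaxation gap is the
> region below ρ(δ;C) but above the information-theoretic limit. Here, the signal is uniquely
> determined by the measurements, but no convex method can recover it."

The classical source is D. L. Donoho, M. Elad, *Optimally sparse representation in general
(nonorthogonal) dictionaries via ℓ¹ minimization*, PNAS 100 (2003) 2197–2202 [DonohoElad2003]
(paywalled for the lane, acquisition request filed), read through the restatement in M. D. Plumbley,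
*On polar polytopes and the recovery of sparse representations*, IEEE Trans. Inf. Theory 53 (2007)
3188–3195 = arXiv:cs/0510032 [Plumbley2007], held text `paper:arxiv-cs_0510032` p0003:

> "We define the Spark of a matrix, σ = Spark(A), to be the smallest number such that there exists
> a subset of σ columns from A that are linearly dependent [DonohoElad03]. Given a matrix
> A ∈ ℝ^{d×n} with n > d, if all subsets of d columns from A are linearly independent, then
> Spark(A) = d+1. **Theorem 1.1** (Donoho and Elad: ℓ₀-Uniqueness). A representation y = A x₀ with
> m = ‖x₀‖₀ nonzeros is ℓ₀-unique-optimal (the sparsest possible representation) if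
> m < Spark(A)/2. In particular this means that if all subsets of d columns of A ∈ ℝ^{d×n} are
> linearly independent, then Theorem 1.1 holds with m < (d+1)/2."

## What is formalised (real matrices, arbitrary finite index types)

* `supp x` (the support as a `Finset`, `(supp x).card = ‖x‖₀`) and `SparkGT A t` ("`Spark(A) > t`":
  every set of at most `t` columns is linearly independent; we avoid defining `Spark` as an
  infimum), `SparkGT.mono`.
* `eq_zero_of_mulVec_eq_zero`: `Spark(A) > t` ⇒ the kernel of `A` contains no nonzero `t`-sparse
  vector.
* **`sparse_solution_unique`** (Donoho–Elad): `Spark(A) > 2k` ⇒ `k`-sparse solutions of `y = A x`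
  are unique among `k`-sparse vectors; **`card_supp_lt_of_ne`**: the printed ℓ₀-unique-optimality
  form (`2‖x₀‖₀ < Spark(A)` ⇒ every other solution has strictly more nonzeros);
  `sparse_solution_unique_of_generalPosition`: the "in particular" (`Spark = d + 1`, `2k ≤ d`).
* `IsBinary x` (`x ∈ {0,1}ⁿ`) and the identifiability remark that types E-61's "information-theoretic
  limit": **`ae_injOn_dotProduct_binary`** — for Lebesgue-a.e. `a ∈ ℝⁿ`, `x ↦ a ⬝ᵥ x` is injective
  on `{0,1}ⁿ` (the bad set is a finite union of the hyperplanes `a ⬝ᵥ (𝟙_S − 𝟙_{S'}) = 0`, each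
  Lebesgue-null by Mathlib's `Measure.addHaar_submodule`); `injOn_mulVec_binary_of_row`;
  **`ae_injOn_mulVec_binary`** — for a.e. `A ∈ ℝ^{m×n}` with `m ≥ 1`, `x ↦ A x` is injective on
  `{0,1}ⁿ`. So with noiseless measurements from any absolutely continuous law (Gaussian included) a
  binary signal — sparse or not — is determined by a SINGLE measurement, and exhaustive search over
  `{0,1}ⁿ` (or over the `C(n,k)` candidate supports) recovers it from any `m ≥ 1`; the E-61 "phase
  transition" at `(n, k, m) = (32, 5, 6)` is therefore a statement about particular algorithms, not
  about what the measurements determine (the lane's E-61 ‘ILL-POSED AT THIS SIZE’ cell, made exact).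

## What is NOT formalised

`Spark` as a number (only the predicate `Spark > t`); that Gaussian matrices have full spark almost
surely (zero sets of nonzero polynomials are null — not needed for the binary statement); anything
about ℓ₁ / LASSO / AMP, the Donoho–Tanner curve `ρ(δ;C)` or the box relaxation (the Mangasarian–Recht
`m/n > 1/2` uniqueness-in-the-hypercube transition); finite-precision or noisy measurements.

## References

* [DonohoElad2003] D. L. Donoho, M. Elad, PNAS 100(5) (2003) 2197–2202, the ℓ₀-uniqueness theorem
  via Spark (original; paywalled here — read through Plumbley2007).
* [Plumbley2007] M. D. Plumbley, IEEE Trans. Inf. Theory 53(9) (2007) 3188–3195 = arXiv:cs/0510032,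
  §1, definition of Spark and Theorem 1.1 (held text p0003).
* [HahnRomero2026] W. Hahn, N. Romero, arXiv:2606.00806 (2026), §II.A–B (held text p0002) — the
  E-61 primary whose sentences are typed here.
-/

noncomputable section

open Matrix Finset MeasureTheory

namespace Literature.Analysis.Matrix

namespace SparseUniqueness

variable {m n : Type*} [Fintype n] [DecidableEq n]

/-! ### `ℓ₀` "norm" (support size) and the spark condition -/

/-- The support of `x` as a `Finset` (so `(supp x).card = ‖x‖₀`, the number of nonzeros).
[cite: Plumbley2007, Thm 1.1 (`m = ‖x‖₀` nonzeros)] -/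
def supp (x : n → ℝ) : Finset n := univ.filter fun j => x j ≠ 0

omit [DecidableEq n] in
/-- Membership in the support: `j ∈ supp x ↔ x j ≠ 0` (so `(supp x).card` counts the nonzeros,
`‖x‖₀`). [cite: Plumbley2007, Thm 1.1 (`m = ‖x₀‖₀` nonzeros)] -/
@[simp] theorem mem_supp {x : n → ℝ} {j : n} : j ∈ supp x ↔ x j ≠ 0 := by
  simp [supp]

/-- **`Spark(A) > t`**: every set of at most `t` columns of `A` is linearly independent ("the Spark
of a matrix [is] the smallest number σ such that there exists a subset of σ columns from A that are
linearly dependent"). [cite: Plumbley2007, §1 definition of Spark (after Donoho–Elad)]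
[cite: DonohoElad2003, Definition of Spark] -/
def SparkGT (A : Matrix m n ℝ) (t : ℕ) : Prop :=
  ∀ s : Finset n, s.card ≤ t → LinearIndependent ℝ (fun j : s => fun i => A i (j : n))

omit [Fintype n] [DecidableEq n] in
/-- Monotonicity of the spark condition. [cite: Plumbley2007, §1] -/
theorem SparkGT.mono {A : Matrix m n ℝ} {t t' : ℕ} (h : SparkGT A t) (htt : t' ≤ t) :
    SparkGT A t' :=
  fun s hs => h s (hs.trans htt)

/-! ### The kernel contains no nonzero `t`-sparse vector -/

omit [DecidableEq n] in
/-- If every `t` columns of `A` are independent, the only `t`-sparse vector in the kernel of `A` is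
`0`. [cite: Plumbley2007, Thm 1.1 (proof idea of Donoho–Elad's ℓ₀-uniqueness)]
[cite: DonohoElad2003, Thm (ℓ₀ uniqueness via Spark)] -/
theorem eq_zero_of_mulVec_eq_zero (A : Matrix m n ℝ) {t : ℕ} (hA : SparkGT A t) {d : n → ℝ}
    (hd : (supp d).card ≤ t) (h0 : A *ᵥ d = 0) : d = 0 := by
  have hli := hA (supp d) hd
  have hsum : ∑ j : supp d, d (j : n) • (fun i => A i (j : n)) = 0 := by
    funext i
    simp only [Finset.sum_apply, Pi.smul_apply, smul_eq_mul, Pi.zero_apply]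
    have h1 : ∑ j : supp d, d (j : n) * A i (j : n) = ∑ j, d j * A i j := by
      rw [Finset.sum_coe_sort (supp d) (fun j => d j * A i j)]
      apply Finset.sum_subset (Finset.subset_univ _)
      intro j _ hj
      rw [mem_supp, not_not] at hj
      rw [hj, zero_mul]
    rw [h1]
    have h2 := congr_fun h0 i
    simp only [Matrix.mulVec, dotProduct, Pi.zero_apply] at h2
    rw [← h2]
    exact Finset.sum_congr rfl fun j _ => mul_comm _ _
  have hcoef := (Fintype.linearIndependent_iff.mp hli) (fun j => d (j : n)) hsum
  funext j
  by_cases hj : d j = 0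
  · exact hj
  · exact hcoef ⟨j, mem_supp.mpr hj⟩

/-! ### Donoho–Elad ℓ₀ uniqueness -/

/-- **Uniqueness of sparse solutions (Donoho–Elad).** If every `2k` columns of `A` are linearly
independent (`Spark(A) > 2k`) then a `k`-sparse solution of `y = A x` is unique among `k`-sparse
vectors. [cite: DonohoElad2003, Thm (ℓ₀ uniqueness: `‖x‖₀ < Spark(A)/2`)]
[cite: Plumbley2007, Thm 1.1 ("A representation y = A x₀ with m = ‖x₀‖₀ nonzeros is
ℓ₀-unique-optimal (the sparsest possible representation) if m < Spark(A)/2")] -/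
theorem sparse_solution_unique (A : Matrix m n ℝ) {k : ℕ} (hA : SparkGT A (2 * k))
    {x x' : n → ℝ} (hx : (supp x).card ≤ k) (hx' : (supp x').card ≤ k)
    (h : A *ᵥ x = A *ᵥ x') : x = x' := by
  have hsub : supp (x - x') ⊆ supp x ∪ supp x' := by
    intro j hj
    rw [Finset.mem_union, mem_supp, mem_supp]
    rw [mem_supp, Pi.sub_apply] at hj
    by_contra hcon
    push Not at hcon
    exact hj (by rw [hcon.1, hcon.2, sub_self])
  have hd : (supp (x - x')).card ≤ 2 * k :=
    calc (supp (x - x')).card ≤ (supp x ∪ supp x').card := Finset.card_le_card hsub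
      _ ≤ (supp x).card + (supp x').card := Finset.card_union_le _ _
      _ ≤ 2 * k := by omega
  have := eq_zero_of_mulVec_eq_zero A hA hd (by rw [Matrix.mulVec_sub, h, sub_self])
  exact sub_eq_zero.mp this

/-- **ℓ₀-unique-optimality, as printed.** If `Spark(A) > t ≥ 2‖x₀‖₀` then every OTHER solution of
`A x = A x₀` has strictly more nonzeros than `x₀` ("the sparsest possible representation").
[cite: DonohoElad2003, Thm (ℓ₀ uniqueness)] [cite: Plumbley2007, Thm 1.1] -/
theorem card_supp_lt_of_ne (A : Matrix m n ℝ) {t : ℕ} (hA : SparkGT A t) {x₀ x : n → ℝ}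
    (hx₀ : 2 * (supp x₀).card ≤ t) (h : A *ᵥ x = A *ᵥ x₀) (hne : x ≠ x₀) :
    (supp x₀).card < (supp x).card := by
  by_contra hle
  push Not at hle
  have hsub : supp (x - x₀) ⊆ supp x ∪ supp x₀ := by
    intro j hj
    rw [Finset.mem_union, mem_supp, mem_supp]
    rw [mem_supp, Pi.sub_apply] at hj
    by_contra hcon
    push Not at hcon
    exact hj (by rw [hcon.1, hcon.2, sub_self])
  have hd : (supp (x - x₀)).card ≤ t :=
    calc (supp (x - x₀)).card ≤ (supp x ∪ supp x₀).card := Finset.card_le_card hsub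
      _ ≤ (supp x).card + (supp x₀).card := Finset.card_union_le _ _
      _ ≤ t := by omega
  have := eq_zero_of_mulVec_eq_zero A hA hd (by rw [Matrix.mulVec_sub, h, sub_self])
  exact hne (sub_eq_zero.mp this)

/-- The "general position" special case: if all sets of `card m` columns are independent
(`Spark(A) = card m + 1`) then `k`-sparse solutions are unique as soon as `2k ≤ card m`
("Theorem 1.1 holds with m < (d+1)/2"). [cite: Plumbley2007, §1 (text after Thm 1.1)] -/
theorem sparse_solution_unique_of_generalPosition [Fintype m] (A : Matrix m n ℝ)
    (hA : SparkGT A (Fintype.card m)) {k : ℕ} (hk : 2 * k ≤ Fintype.card m)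
    {x x' : n → ℝ} (hx : (supp x).card ≤ k) (hx' : (supp x').card ≤ k)
    (h : A *ᵥ x = A *ᵥ x') : x = x' :=
  sparse_solution_unique A (hA.mono hk) hx hx' h

/-! ### Binary signals: ONE generic noiseless measurement already determines the signal -/

section Binary

variable {ι : Type*} [Fintype ι]

/-- Binary (0/1-valued) real vectors. [cite: HahnRomero2026, §II.A ("a k-sparse binary signal
x ∈ {0,1}ⁿ and m < n measurements y = A x")] -/
def IsBinary (x : ι → ℝ) : Prop := ∀ j, x j = 0 ∨ x j = 1

/-- A hyperplane `{a | a ⬝ᵥ c = 0}` (`c ≠ 0`) is Lebesgue-null. [folklore] -/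
private theorem volume_dotProduct_eq_zero (c : ι → ℝ) (hc : c ≠ 0) :
    volume {a : ι → ℝ | a ⬝ᵥ c = 0} = 0 := by
  let φ : (ι → ℝ) →ₗ[ℝ] ℝ :=
    { toFun := fun a => a ⬝ᵥ c
      map_add' := fun a b => add_dotProduct a b c
      map_smul' := fun r a => by simp [smul_dotProduct] }
  have hker : {a : ι → ℝ | a ⬝ᵥ c = 0} = (LinearMap.ker φ : Set (ι → ℝ)) := by
    ext a
    simp [φ]
  have hne : LinearMap.ker φ ≠ ⊤ := by
    intro htop
    have hc' : c ∈ LinearMap.ker φ := htop ▸ Submodule.mem_top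
    rw [LinearMap.mem_ker] at hc'
    exact hc (dotProduct_self_eq_zero.mp hc')
  rw [hker]
  exact Measure.addHaar_submodule volume _ hne

variable [DecidableEq ι]

/-- The indicator vector of a finite set of coordinates. [folklore] -/
private def ind (S : Finset ι) : ι → ℝ := fun j => if j ∈ S then 1 else 0

omit [Fintype ι] in
/-- Distinct coordinate sets have distinct indicator vectors. [folklore] -/
private theorem ind_injective : Function.Injective (ind (ι := ι)) := by
  intro S S' h
  ext j
  have hj := congr_fun h j
  simp only [ind] at hj
  by_cases h1 : j ∈ S <;> by_cases h2 : j ∈ S' <;> simp_all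

/-- A binary vector is the indicator of its set of `1`s. [folklore] -/
private theorem eq_ind_of_isBinary {x : ι → ℝ} (hx : IsBinary x) :
    x = ind (univ.filter fun j => x j = 1) := by
  funext j
  simp only [ind, Finset.mem_filter, Finset.mem_univ, true_and]
  rcases hx j with h | h
  · rw [h, if_neg (by norm_num)]
  · rw [h, if_pos rfl]

/-- **Almost every single measurement vector separates all binary signals.** For Lebesgue-a.e.
`a ∈ ℝⁿ` the map `x ↦ a ⬝ᵥ x` is injective on `{0,1}ⁿ` (the `2ⁿ` subset sums of `a` are pairwise
distinct off a finite union of hyperplanes). Hence with NOISELESS real measurements `y = A x` and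
`A` drawn from any law absolutely continuous w.r.t. Lebesgue measure (e.g. Gaussian), a binary signal
is information-theoretically determined by ONE measurement, whatever its sparsity: the printed
"relaxation gap … Here, the signal is uniquely determined by the measurements, but no convex method
can recover it" is a statement about ALGORITHMS (the Donoho–Tanner curve for the convex relaxation),
not about identifiability. [cite: HahnRomero2026, §II.B ("The relaxation gap is the region below
ρ(δ;C) but above the information-theoretic limit. Here, the signal is uniquely determined by the
measurements")] -/
theorem ae_injOn_dotProduct_binary :
    ∀ᵐ a : ι → ℝ ∂volume, Set.InjOn (fun x : ι → ℝ => a ⬝ᵥ x) {x | IsBinary x} := by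
  rw [ae_iff]
  have hcover : {a : ι → ℝ | ¬ Set.InjOn (fun x : ι → ℝ => a ⬝ᵥ x) {x | IsBinary x}} ⊆
      ⋃ p : Finset ι × Finset ι, {a | p.1 ≠ p.2 ∧ a ⬝ᵥ (ind p.1 - ind p.2) = 0} := by
    intro a ha
    rw [Set.mem_setOf_eq, Set.InjOn] at ha
    push Not at ha
    obtain ⟨x, hx, x', hx', heq, hne⟩ := ha
    rw [Set.mem_setOf_eq] at hx hx'
    refine Set.mem_iUnion.mpr ⟨(univ.filter fun j => x j = 1, univ.filter fun j => x' j = 1), ?_⟩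
    rw [Set.mem_setOf_eq]
    constructor
    · intro hSS
      apply hne
      rw [eq_ind_of_isBinary hx, eq_ind_of_isBinary hx']
      exact congrArg ind hSS
    · show a ⬝ᵥ (ind (univ.filter fun j => x j = 1) - ind (univ.filter fun j => x' j = 1)) = 0
      rw [← eq_ind_of_isBinary hx, ← eq_ind_of_isBinary hx', dotProduct_sub, sub_eq_zero]
      exact heq
  refine measure_mono_null hcover (measure_iUnion_null fun p => ?_)
  by_cases hp : p.1 = p.2
  · have he : {a : ι → ℝ | p.1 ≠ p.2 ∧ a ⬝ᵥ (ind p.1 - ind p.2) = 0} = ∅ := by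
      ext a
      simp [hp]
    rw [he, measure_empty]
  · have he : {a : ι → ℝ | p.1 ≠ p.2 ∧ a ⬝ᵥ (ind p.1 - ind p.2) = 0} =
        {a : ι → ℝ | a ⬝ᵥ (ind p.1 - ind p.2) = 0} := by
      ext a
      simp [hp]
    rw [he]
    exact volume_dotProduct_eq_zero _ (sub_ne_zero.mpr fun h => hp (ind_injective h))

omit [DecidableEq ι] in
/-- If ONE row of `A` separates binary vectors then so does `A`. [cite: HahnRomero2026, §II.A
(`y = A x`, `x ∈ {0,1}ⁿ`)] -/
theorem injOn_mulVec_binary_of_row {κ : Type*} (A : Matrix κ ι ℝ) (i₀ : κ)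
    (h : Set.InjOn (fun x : ι → ℝ => A i₀ ⬝ᵥ x) {x | IsBinary x}) :
    Set.InjOn (fun x : ι → ℝ => A *ᵥ x) {x | IsBinary x} :=
  fun _ hx _ hx' hAx => h hx hx' (by simpa [Matrix.mulVec] using congr_fun hAx i₀)

/-- **Generic measurement matrices are injective on binary signals, for every `m ≥ 1`.** For
Lebesgue-a.e. `A ∈ ℝ^{m×n}` (entries jointly absolutely continuous, e.g. i.i.d. Gaussian) and any
`x ≠ x'` in `{0,1}ⁿ`, `A x ≠ A x'`: noiseless binary compressed sensing has no identifiability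
threshold above `m = 1` — exhaustive search over `{0,1}ⁿ` (or over the `C(n,k)` supports) recovers
the signal exactly from any `m ≥ 1` generic measurements. [cite: HahnRomero2026, §II.B
("information-theoretic limit … the signal is uniquely determined by the measurements") and
abstract ("At n = 32, k = 5, m/n = 0.19")] -/
theorem ae_injOn_mulVec_binary {κ : Type*} [Fintype κ] [Nonempty κ] :
    ∀ᵐ A : κ → ι → ℝ ∂volume,
      Set.InjOn (fun x : ι → ℝ => Matrix.of A *ᵥ x) {x | IsBinary x} := by
  obtain ⟨i₀⟩ := ‹Nonempty κ›
  have h1 : ∀ᵐ A : κ → ι → ℝ ∂(Measure.pi fun _ : κ => (volume : Measure (ι → ℝ))),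
      Set.InjOn (fun x : ι → ℝ => A i₀ ⬝ᵥ x) {x | IsBinary x} :=
    (Measure.tendsto_eval_ae_ae (μ := fun _ : κ => (volume : Measure (ι → ℝ))) (i := i₀)).eventually
      ae_injOn_dotProduct_binary
  rw [← volume_pi] at h1
  exact h1.mono fun A hA => injOn_mulVec_binary_of_row (Matrix.of A) i₀ hA

end Binary

end SparseUniqueness

end Literature.Analysis.Matrix
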